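import Summits.KontsevichZagierPeriods.KontsevichZagierPeriods.Theorems.LinRedNormalFormArrangementNormalFormStubRebaseSimplePosCells

/-!
# Stub `stub_rebaseSimplePosOne` (crux `ArrangementNormalForm`, line `janus-bands`, v6.2) —
part `OrderGood`: total-order refinement with a per-cell callback

`RebasePos.orderCells_good`: the `GG`-text total-order refinement `RebasePos.orderCells`
(rule 1a: an order-constrained representation — domain cut out by finitely many strict
comparisons between players, fibres and affine forms of the base `(x', y)` — with the literal
`GG` integrand is the sum of its restrictions to the chains of players, the inconsistent chains
being empty), with the conclusion "congruent to the subgroup generated by an ARBITRARY set `S`"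
drawn from a CALLBACK on the literal cells: every cell is handed over with its literal data
(`gDom` rows = differences of adjacent affine players, bounds = the chain neighbours of each
fibre, the same integrand), its inclusion in the original domain, and the provenance of its
bounds (fibres, or affine players of the constraint set). This is the dissection step of the
coordinate swap `y ↔ t` of the one-fibre rebase (part `Swap`), whose cells must be processed
further (they are not yet in `GG B 2 1`). Registered as `rebaseSimplePos_orderCellsGood`.

References: M. Kontsevich, D. Zagier, *Periods* (2001), §1.2, rule (1).
-/

noncomputable section

open Set MeasureTheory MvPolynomial
open Literature.NumberTheory.Transcendental Literature.ModelTheory.ExponentialFields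

namespace Summit.KontsevichZagierPeriods.ArrangementNormalForm.JanusBands

namespace RebasePos

open SeparatePos

section OrderGood

open IntegrateOutLow

variable {b K : ℕ}

/-- **Total-order refinement with a per-cell callback** (rule 1a). Let the domain of `s` be cut
out by the strict comparisons `C` between players (every fibre compared at least once from
below and from above) and let its integrand be the literal `GG` integrand. If every LITERAL
CELL of `s` — a representation `s'` with `s'.domain ⊆ s.domain`, literal domain
`gDom b K m' M lo hi` whose affine bounds are affine players of `C`, the same integrand — is
congruent modulo `KZ.relations` to the subgroup generated by `S`, then so is `s`. -/
theorem orderCells_good {m n₁ n₂ : ℕ} (S : Set KZ.FormalRep) (s : KZ.IntegralRep (b + 1 + K))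
    (C : Finset ((Fin K ⊕ ((Fin (b + 1) → ℚ) × ℚ)) × (Fin K ⊕ ((Fin (b + 1) → ℚ) × ℚ))))
    (L : Fin m → (Fin b → ℚ) × ℚ) (e : Fin m → ℕ) (p : MvPolynomial (Fin b) ℚ)
    (ℓ₁ ℓ₂ : (Fin b → ℚ) × ℚ) (a : Fin K → Option ((Fin (b + 1) → ℚ) × ℚ))
    (hbd : Bornology.IsBounded s.domain)
    (hlu : ∀ v, (∃ q ∈ C, q.2 = Sum.inl v) ∧ (∃ q ∈ C, q.1 = Sum.inl v))
    (hdom : s.domain = {z | ∀ q ∈ C, pv q.1 z < pv q.2 z})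
    (hint : EqOn s.integrand (glit b K p L e ℓ₁ ℓ₂ n₁ n₂ a) s.domain)
    (hpiece : ∀ (m' : ℕ) (s' : KZ.IntegralRep (b + 1 + K)) (M : Fin m' → (Fin (b + 1) → ℚ) × ℚ)
      (lo hi : Fin K → Fin K ⊕ ((Fin (b + 1) → ℚ) × ℚ)), s'.domain ⊆ s.domain →
      Bornology.IsBounded s'.domain → s'.domain = gDom b K m' M lo hi →
      EqOn s'.integrand (glit b K p L e ℓ₁ ℓ₂ n₁ n₂ a) s'.domain →
      (∀ i d, (lo i = Sum.inr d ∨ hi i = Sum.inr d) → ∃ q ∈ C, q.1 = Sum.inr d ∨ q.2 = Sum.inr d) →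
      ∃ c ∈ AddSubgroup.closure S, KZ.of s' - c ∈ KZ.relations) :
    ∃ c ∈ AddSubgroup.closure S, KZ.of s - c ∈ KZ.relations := by
  classical
  set A : Finset ((Fin (b + 1) → ℚ) × ℚ) :=
    C.biUnion fun q => q.1.getRight?.toFinset ∪ q.2.getRight?.toFinset with hA_def
  have hA : ∀ q ∈ C, ∀ d, (q.1 = Sum.inr d ∨ q.2 = Sum.inr d) → d ∈ A := by
    intro q hq d h
    rw [hA_def, Finset.mem_biUnion]
    refine ⟨q, hq, ?_⟩
    rcases h with h | h <;> simp [h]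
  have hA' : ∀ d ∈ A, ∃ q ∈ C, q.1 = Sum.inr d ∨ q.2 = Sum.inr d := by
    intro d hd
    rw [hA_def, Finset.mem_biUnion] at hd
    obtain ⟨q, hq, h⟩ := hd
    refine ⟨q, hq, ?_⟩
    rwa [Finset.mem_union, Option.mem_toFinset, Option.mem_toFinset, Option.mem_def,
      Option.mem_def, Sum.getRight?_eq_some_iff, Sum.getRight?_eq_some_iff] at h
  set P : Fin K ⊕ A → MvPolynomial (Fin (b + 1 + K)) ℚ := fun x =>
    Sum.elim (fun v => (X (Fin.natAdd (b + 1) v) : MvPolynomial (Fin (b + 1 + K)) ℚ))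
      (fun d => rename (Fin.castAdd K) (∑ i, MvPolynomial.C (d.1 i) * X i + MvPolynomial.C d.2))
      (Sum.map id Subtype.val x) with hP_def
  have hval : ∀ x z, aeval z (P x) = pv (Sum.map id Subtype.val x) z := fun x z =>
    aeval_player _ z
  have hP : ∀ x y, x ≠ y → ∃ z, aeval z (P x) ≠ aeval z (P y) := fun x y hxy => by
    obtain ⟨z, hz⟩ := player_ne (b := b + 1) (K := K) (fun h => hxy
      (Sum.map_injective.2 ⟨fun _ _ h => h, Subtype.val_injective⟩ h))
    exact ⟨z, by rwa [hval, hval]⟩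
  have hsplit := of_sub_sum_cell_mem_relations P hP s
  have hcell : ∀ σ : Fin (Fintype.card (Fin K ⊕ A)) ≃ Fin K ⊕ A,
      {z : Fin (b + 1 + K) → ℝ | StrictMono fun i => aeval z (P (σ i))} =
      {z | StrictMono fun i => pv (Sum.map id Subtype.val (σ i)) z} := fun σ => by
    simp_rw [hval]
  set piece := fun σ : Fin (Fintype.card (Fin K ⊕ A)) ≃ Fin K ⊕ A =>
    s.restrict (s.domain ∩ {z | StrictMono fun i => aeval z (P (σ i))})
      (s.isSemialgebraic_domain.inter (isSemialgebraic_cell P σ)) inter_subset_left with hpiece_def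
  set good := fun σ : Fin (Fintype.card (Fin K ⊕ A)) ≃ Fin K ⊕ A =>
    ∀ q ∈ C, ∃ x₁ x₂ : Fin K ⊕ A, Sum.map id Subtype.val x₁ = q.1 ∧
      Sum.map id Subtype.val x₂ = q.2 ∧ σ.symm x₁ < σ.symm x₂ with hgood_def
  -- consistent chains: the callback
  have hgood : ∀ σ, good σ → ∃ c ∈ AddSubgroup.closure S, KZ.of (piece σ) - c ∈ KZ.relations := by
    intro σ hσ
    obtain ⟨lo', hi', hEq⟩ := exists_inter_chain_eq' pv A C σ hσ hlu
    have hmem : ∀ (x : Fin K ⊕ A) (d : (Fin (b + 1) → ℚ) × ℚ),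
        Sum.map id Subtype.val x = Sum.inr d → d ∈ A := by
      rintro (v | ⟨d₀, hd₀⟩) d h
      · simp at h
      · simp only [Sum.map_inr, Sum.inr.injEq] at h
        exact h ▸ hd₀
    refine hpiece (Fintype.card (Fin K ⊕ A)) (piece σ) (fun i =>
      if h : i.val + 1 < Fintype.card (Fin K ⊕ A) then
        Sum.elim (fun _ => ((0 : Fin (b + 1) → ℚ), (1 : ℚ))) (fun d => Sum.elim (fun _ => (0, 1))
          (fun d' => (d'.1 - d.1, d'.2 - d.2)) (Sum.map id Subtype.val (σ ⟨i.val + 1, h⟩)))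
          (Sum.map id Subtype.val (σ i)) else (0, 1))
      (fun v => Sum.map id Subtype.val (lo' v)) (fun v => Sum.map id Subtype.val (hi' v))
      inter_subset_left (hbd.subset inter_subset_left) ?_ (hint.mono inter_subset_left)
      (fun i d hd => ?_)
    · show s.domain ∩ {z | StrictMono fun i => aeval z (P (σ i))} = _
      rw [hdom, hcell σ, hEq]
      ext z
      simp only [mem_setOf_eq]
      refine and_congr ⟨fun h j => ?_, fun h i hi d d' h1 h2 => ?_⟩ Iff.rfl
      · dsimp only
        by_cases hj : j.val + 1 < Fintype.card (Fin K ⊕ A)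
        · rw [dif_pos hj]
          rcases h1 : Sum.map id Subtype.val (σ j) with v | d
          · simp
          · rcases h2 : Sum.map id Subtype.val (σ ⟨j.val + 1, hj⟩) with v' | d'
            · simp
            · have hlt := h j hj d d' h1 h2
              simp only [Sum.elim_inr, Pi.sub_apply, sub_row_pos_iff]
              exact hlt
        · rw [dif_neg hj]
          simp
      · have hr := h i
        dsimp only at hr
        rw [dif_pos hi, h1, h2] at hr
        simp only [Sum.elim_inr, Pi.sub_apply, sub_row_pos_iff] at hr
        exact hr
    · have hdA : d ∈ A := by
        rcases hd with hd | hd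
        · exact hmem _ _ hd
        · exact hmem _ _ hd
      exact hA' d hdA
  -- inconsistent chains: empty pieces
  have hbad : ∀ σ, ¬ good σ → KZ.of (piece σ) ∈ KZ.relations := by
    intro σ hσ
    refine KZ.of_mem_relations_of_volume_eq_zero _ ?_
    show volume (s.domain ∩ {z | StrictMono fun i => aeval z (P (σ i))}) = 0
    rw [hdom, hcell σ, inter_chain_eq_empty pv A C hA σ hσ, measure_empty]
  -- assembling
  set c : (Fin (Fintype.card (Fin K ⊕ A)) ≃ Fin K ⊕ A) → KZ.FormalRep := fun σ =>
    if h : good σ then (hgood σ h).choose else 0 with hc_def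
  have hc : ∀ σ, c σ ∈ AddSubgroup.closure S ∧ KZ.of (piece σ) - c σ ∈ KZ.relations := by
    intro σ
    by_cases h : good σ
    · have hs := (hgood σ h).choose_spec
      simp only [hc_def, dif_pos h]
      exact hs
    · simp only [hc_def, dif_neg h, sub_zero]
      exact ⟨zero_mem _, hbad σ h⟩
  refine ⟨∑ σ, c σ, AddSubgroup.sum_mem _ fun σ _ => (hc σ).1, ?_⟩
  have hsum : ∑ σ, (KZ.of (piece σ) - c σ) ∈ KZ.relations := sum_mem fun σ _ => (hc σ).2
  have key := KZ.relations.add_mem hsplit hsum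
  rw [Finset.sum_sub_distrib] at key
  convert key using 1
  abel

end OrderGood

end RebasePos

/-- Registered support goal of this file: total-order refinement of an order-constrained
`GG`-text representation with a per-cell callback (`RebasePos.orderCells_good`). -/
theorem rebaseSimplePos_orderCellsGood (b K m n₁ n₂ : ℕ) (S : Set KZ.FormalRep) (s : KZ.IntegralRep (b + 1 + K)) (C : Finset ((Fin K ⊕ ((Fin (b + 1) → ℚ) × ℚ)) × (Fin K ⊕ ((Fin (b + 1) → ℚ) × ℚ)))) (L : Fin m → (Fin b → ℚ) × ℚ) (e : Fin m → ℕ) (p : MvPolynomial (Fin b) ℚ) (ℓ₁ ℓ₂ : (Fin b → ℚ) × ℚ) (a : Fin K → Option ((Fin (b + 1) → ℚ) × ℚ)) (hbd : Bornology.IsBounded s.domain) (hlu : ∀ v, (∃ q ∈ C, q.2 = Sum.inl v) ∧ (∃ q ∈ C, q.1 = Sum.inl v)) (hdom : s.domain = {z | ∀ q ∈ C, RebasePos.pv q.1 z < RebasePos.pv q.2 z}) (hint : EqOn s.integrand (RebasePos.glit b K p L e ℓ₁ ℓ₂ n₁ n₂ a) s.domain) (hpiece : ∀ (m' : ℕ)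 (s' : KZ.IntegralRep (b + 1 + K)) (M : Fin m' → (Fin (b + 1) → ℚ) × ℚ) (lo hi : Fin K → Fin K ⊕ ((Fin (b + 1) → ℚ) × ℚ)), s'.domain ⊆ s.domain → Bornology.IsBounded s'.domain → s'.domain = SeparatePos.gDom b K m' M lo hi → EqOn s'.integrand (RebasePos.glit b K p L e ℓ₁ ℓ₂ n₁ n₂ a) s'.domain → (∀ i d, (lo i = Sum.inr d ∨ hi i = Sum.inr d) → ∃ q ∈ C, q.1 = Sum.inr d ∨ q.2 = Sum.inr d) → ∃ c ∈ AddSubgroup.closure S, KZ.of s' - c ∈ KZ.relations) : ∃ c ∈ AddSubgroup.closure S, KZ.of s - c ∈ KZ.relations :=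
  RebasePos.orderCells_good S s C L e p ℓ₁ ℓ₂ a hbd hlu hdom hint hpiece

end Summit.KontsevichZagierPeriods.ArrangementNormalForm.JanusBands
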